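import Literature.NumberTheory.EllipticCurves.ZpExtensionEisensteinTwistCores
import Literature.NumberTheory.EllipticCurves.ZpExtensionEisensteinH1Data
import Literature.NumberTheory.EllipticCurves.LambdaAdicSelmerDataCoresProofs
import Literature.NumberTheory.EllipticCurves.PeriodIndexCorestrictionLocal
import HarnessLib

/-!
# The compact control map `𝔖_p(K_∞) → H¹(K, T_𝔮)` at the Eisenstein prime `𝔮 = (T^m + p)`: its level
# components, their independence of the auxiliary layer, their compatibility with the reductions
# `T_𝔮/p^{k+1} → T_𝔮/p^k`, and the lift to the pinned `H¹(K, T_𝔮)` (definitions with bodies + theorems)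

Topic `NumberTheory/EllipticCurves` (sequel of `ZpExtensionEisensteinTwistCores` + `LambdaAdicSelmerDataCoresProofs`,
consumer of `ZpExtensionEisensteinH1Data`). Cell `pub/bsd-print-x9`, D1 road of the shared μ-residual of rows 9/10
(PORT-ALGEBRA-LAYER §5 step 2 «S1: the compact control map `f : 𝔖 → H`» of the witness interface `SpecWitness`).

Setting: `E = V` an elliptic curve over a number field `K` with `E(K)[p] = 0`, `κ : ZpExtension K p` with topological
generator `γ`, `D : V.LambdaAdicSelmerData κ γ` (Perrin-Riou's `𝔖_p(K_∞) = lim← S_p(E/K_n)`, pinned; `T ↦ conj_γ − 1`),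
`m ≥ 1`, and — SIGN CONVENTION ruled by the cell's D1 LEAD (2026-08-28), see `ZpExtensionEisensteinTwistCores` §3 —
the INVERSE extension `κ⁻ := κ.unitTwist (-1)` (same layers `Γ_n`, `layerSubgroup_unitTwist`; `κ̄⁻_J(γ) = −1`), whose
Eisenstein twists `κ⁻.eisensteinTwist (E[p^k]) hm k = E[p^k] ⊗ A_{m,k}(ψ⁻¹)` are Howard's `T_𝔮/p^k T_𝔮`
[Howard 2004, §2.2; proof of Thm. 2.2.10, "taking `𝔮 = T^m + p`"] in the convention making the control map `Λ`-LINEAR.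

* §1 **`eisensteinComponent D hm k n hn : D.S →+ H¹(K, E[p^k] ⊗ A_{m,k}(ψ⁻¹))`** `:= coresEisenstein κ⁻ (Γ_n) ∘ (proj_n · k)`
  (`n ≥ J_k = eisensteinLevel hm k`): the level-`(n, k)` value of Howard's map `𝔖 → H¹(K, T_𝔮)` [Howard 2004, §2.2,
  Lemma 2.2.7 / Prop. 2.2.8]; **independent of `n`** (`eisensteinComponent_eq_of_le`: `coresEisenstein_coresLe` +
  `coresLe_proj_eq_proj`, uses `E(K)[p] = 0`); **compatible with the reductions** (`map_reduce_eisensteinComponent`: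
  `H¹(eisensteinTwistReduce (t k)) ∘ comp_{k+1} = comp_k` for any equivariant lift `t k` of `P ↦ p•P`, by
  `map_eisensteinTwistReduce_coresEisenstein` + the `p`-compatibility of `S_p(E/K_n)`, `mem_compactSelmerOver_iff`);
  it intertwines `conj_γ − 1` with `T` (`comp (T • s) = H¹((1+T)•)(comp s) − comp s`, from `LambdaAdicSelmerData.proj_X`
  and `coresEisenstein_conjMap_of_layerIndex_eq_neg_one` — proved in the sequel file with the full `Λ`-linearity).
* §2 **the lift**: for `I : EisensteinH1Data κ⁻ (k ↦ E[p^k]) t hm` (the pinned `H¹(K, T_𝔮)`, p637499),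
  `exists_forall_proj_eq_eisensteinComponent` (`I.surj`) and **`toEisensteinH1 D hm I : D.S →+ I.H`** with
  `proj_toEisensteinH1 : I.proj k (toEisensteinH1 s) = eisensteinComponent D hm k n hn s` for EVERY `n ≥ J_k`
  (uniqueness `I.ext`). Its `Λ`-linearity (`toEisensteinH1 (f • s) = f • toEisensteinH1 s`, via `proj_X`/`proj_C`/`proj_cont`)
  is the sequel file; the Selmer conditions (`f(𝔖) ⊆ H¹_{F_𝔮}`) and the control bounds are NOT here.

DEFINITIONS WITH BODIES + theorems; nothing asserted about `L`-functions or BSD; no instance, no notation, no `sorry`.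
BSD is not proved by any of this.

References: [Howard2004HeegnerKolyvagin] B. Howard, Compositio Math. 140 (2004), §2.2, Def. 2.2.3, Lemma 2.2.7, Prop. 2.2.8,
proof of Thm. 2.2.10; [PerrinRiou1987BSMF] B. Perrin-Riou, Bull. SMF 115 (1987), §0 p. 402; [MazurRubinMemoirs2004] §5.3;
[SerreGaloisCohomology1997] I §2.4–§2.5; [Washington1997] §13.1–§13.2.
-/

noncomputable section

open scoped Topology Classical ContRepresentation
open Field CategoryTheory

universe u

/-! ## §1 The level components of the control map -/

namespace WeierstrassCurve.LambdaAdicSelmerData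

open Literature.NumberTheory.EllipticCurves Literature.NumberTheory.GaloisRepresentations
open Literature.NumberTheory.EllipticCurves.ZpExtension (eisensteinLevel)

variable {K : Type u} [Field K] [NumberField K] {V : WeierstrassCurve K} [V.IsElliptic] {p : ℕ} [hp : Fact p.Prime]
  {κ : ZpExtension K p} {γ : absoluteGaloisGroup K} (D : V.LambdaAdicSelmerData κ γ) {m : ℕ} (hm : 1 ≤ m)

omit [NumberField K] [V.IsElliptic] in
/-- `Γ_n ≤ Γ⁻_{J_k}` for `n ≥ J_k`: the layers of `κ⁻ = κ.unitTwist (-1)` are those of `κ`. [cite: Washington1997, §13.1] -/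
theorem layerSubgroup_le_unitTwist_layerSubgroup {k n : ℕ} (hn : eisensteinLevel (p := p) hm k ≤ n) :
    κ.layerSubgroup n ≤ (κ.unitTwist (-1)).layerSubgroup (eisensteinLevel (p := p) hm k) := by
  rw [ZpExtension.layerSubgroup_unitTwist]
  exact κ.layerSubgroup_antitone hn

/-- **The level-`(n, k)` component of the compact control map**: `s ↦ cor_{Γ_n}^{Γ_K}(1 ⊗ (proj_n s)_k) ∈
H¹(K, E[p^k] ⊗ A_{m,k}(ψ⁻¹))` (`coresEisenstein` of the inverse extension on the `k`-th component of `proj n`,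
`n ≥ J_k`) — Howard's `𝔖 → H¹(K, T_𝔮) → H¹(K, T_𝔮/p^k T_𝔮)` evaluated through the layer `K_n`.
[cite: Howard2004HeegnerKolyvagin, §2.2, Lemma 2.2.7 and Prop. 2.2.8] [cite: SerreGaloisCohomology1997, I §2.5 (b)] -/
def eisensteinComponent (k n : ℕ) (hn : eisensteinLevel (p := p) hm k ≤ n) :
    D.S →+ galoisCohomology ((κ.unitTwist (-1)).eisensteinTwist (V.torsionGaloisModule ((p : ℤ) ^ k)) hm k) 1 :=
  haveI := κ.fintypeQuotientLayer n
  ((κ.unitTwist (-1)).coresEisenstein (V.torsionGaloisModule ((p : ℤ) ^ k)) hm k (κ.layerSubgroup n)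
      (layerSubgroup_le_unitTwist_layerSubgroup hm hn) (κ.isOpen_layerSubgroup n)).comp
    ((Pi.evalAddMonoidHom (fun j : ℕ ↦ V.torsionH1Over ((p : ℤ) ^ j) (κ.layerSubgroup n)) k).comp (D.proj n))

omit [V.IsElliptic] in
/-- Unfolding `eisensteinComponent` (for ANY finiteness structure on `Γ_K ⧸ Γ_n`).
[cite: Howard2004HeegnerKolyvagin, §2.2] -/
theorem eisensteinComponent_apply (k n : ℕ) (hn : eisensteinLevel (p := p) hm k ≤ n)
    [hF : Fintype (absoluteGaloisGroup K ⧸ κ.layerSubgroup n)] (s : D.S) :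
    D.eisensteinComponent hm k n hn s =
      (κ.unitTwist (-1)).coresEisenstein (V.torsionGaloisModule ((p : ℤ) ^ k)) hm k (κ.layerSubgroup n)
        (layerSubgroup_le_unitTwist_layerSubgroup hm hn) (κ.isOpen_layerSubgroup n) (D.proj n s k) := by
  have : hF = κ.fintypeQuotientLayer n := Subsingleton.elim _ _
  subst this
  rfl

/-- **Independence of the auxiliary layer**: for `J_k ≤ n ≤ n'` the level components agree,
`comp_{n'} = comp_n` — `coresEisenstein Γ_{n'} = coresEisenstein Γ_n ∘ cor_{Γ_{n'} → Γ_n}` (`coresEisenstein_coresLe`)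
and `cor (proj n' s) = proj n s` on `𝔖_p(K_∞)` when `E(K)[p] = 0` (`coresLe_proj_eq_proj`).
[cite: Howard2004HeegnerKolyvagin, §2.2 (𝔖 = lim← H¹(K_n, T))] [cite: PerrinRiou1987BSMF, §0 p. 402] -/
theorem eisensteinComponent_eq_of_le (hγ : κ.IsTopGenerator γ) (hE : ∀ P : V.toAffine.Point, p • P = 0 → P = 0)
    (k : ℕ) {n n' : ℕ} (hn : eisensteinLevel (p := p) hm k ≤ n) (hnn' : n ≤ n') (s : D.S) :
    D.eisensteinComponent hm k n' (hn.trans hnn') s = D.eisensteinComponent hm k n hn s := by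
  rcases hnn'.eq_or_lt with rfl | hlt
  · rfl
  haveI := κ.fintypeQuotientLayer n
  haveI := κ.fintypeQuotientLayer n'
  have hfin : ∀ j : ℕ, (κ.layerSubgroup j).FiniteIndex := fun j ↦
    ⟨by rw [κ.index_layerSubgroup j]; exact pow_ne_zero _ hp.out.ne_zero⟩
  haveI := hfin
  haveI : Fintype (κ.layerSubgroup n ⧸ (κ.layerSubgroup n').subgroupOf (κ.layerSubgroup n)) := Fintype.ofFinite _
  rw [eisensteinComponent_apply, eisensteinComponent_apply,
    (κ.unitTwist (-1)).coresEisenstein_coresLe (V.torsionGaloisModule ((p : ℤ) ^ k)) hm k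
      (layerSubgroup_le_unitTwist_layerSubgroup hm hn) (κ.layerSubgroup_antitone hnn')
      (κ.isOpen_layerSubgroup n) (κ.isOpen_layerSubgroup n'),
    D.coresLe_proj_eq_proj hγ hE k hlt]

/-- The value at the canonical layer `n = J_k`. [cite: Howard2004HeegnerKolyvagin, §2.2] -/
theorem eisensteinComponent_eq_self (hγ : κ.IsTopGenerator γ) (hE : ∀ P : V.toAffine.Point, p • P = 0 → P = 0)
    (k : ℕ) {n : ℕ} (hn : eisensteinLevel (p := p) hm k ≤ n) (s : D.S) :
    D.eisensteinComponent hm k n hn s = D.eisensteinComponent hm k (eisensteinLevel (p := p) hm k) le_rfl s :=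
  D.eisensteinComponent_eq_of_le hm hγ hE k le_rfl hn s

section Reduce

variable (t : ∀ k, (V.torsionGaloisModule ((p : ℤ) ^ (k + 1))).toContRepresentation →ⁱL
  (V.torsionGaloisModule ((p : ℤ) ^ k)).toContRepresentation)
  (ht : ∀ k (P : geomTorsion V ((p : ℤ) ^ (k + 1))), t k P = V.geomTorsionReduce p k P)

include ht

omit [NumberField K] [V.IsElliptic] hp in
/-- An equivariant lift `t k` of `P ↦ p • P : E[p^{k+1}] → E[p^k]` induces on `H¹(Γ_n, ·)` the tree's transition
map `reduceTorsionH1` of `S_p(E/K_n) = lim← H¹(K_n, E[p^k])`. [cite: PerrinRiou1987BSMF, §0 p. 401] -/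
theorem cohomologyMap_subgroupRepHom_eq_reduceTorsionH1 (k : ℕ) (N : Subgroup (absoluteGaloisGroup K))
    (y : V.torsionH1Over ((p : ℤ) ^ (k + 1)) N) :
    cohomologyMap (subgroupRepHom (TopRep.ofHom ⟨(t k).toContinuousLinearMap, (t k).isIntertwining'⟩) N) 1 y =
      V.reduceTorsionH1 p k N y := by
  obtain ⟨φ, rfl⟩ :=
    oneCocycleClass_surjective (subgroupRep (V.torsionGaloisModule ((p : ℤ) ^ (k + 1))).toTopRep N) y
  rw [cohomologyMap_oneCocycleClass]
  change _ = resH1Hom (ContinuousMonoidHom.id N) (V.geomTorsionReduce p k) _ (oneCocycleClass _ φ)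
  rw [resH1Hom_oneCocycleClass]
  refine congrArg _ (Subtype.ext (ContinuousMap.ext fun x ↦ ?_))
  rw [pullback_id_resIdHom_apply, subgroupRepHom_hom_apply, pullback_resHomOfEquivariant_apply]
  exact ht k (φ.1 x)

omit [V.IsElliptic] in
/-- **Compatibility with the reductions `T_𝔮/p^{k+1} → T_𝔮/p^k`**: for `n` above both `J_{k+1}` and `J_k`,
`H¹(eisensteinTwistReduce (t k)) (comp_{k+1,n} s) = comp_{k,n} s` — naturality of `coresEisenstein` in `(k, M)`
(`map_eisensteinTwistReduce_coresEisenstein`) and the `p`-compatibility `p_* (proj n s)_{k+1} = (proj n s)_k` of the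
compact Selmer group (`mem_compactSelmerOver_iff`). [cite: Howard2004HeegnerKolyvagin, §2.2 and Def. 2.2.3]
[cite: PerrinRiou1987BSMF, §0 p. 401] -/
theorem map_reduce_eisensteinComponent (k n : ℕ) (hn' : eisensteinLevel (p := p) hm (k + 1) ≤ n)
    (hn : eisensteinLevel (p := p) hm k ≤ n) (s : D.S) :
    galoisCohomology.map ((κ.unitTwist (-1)).eisensteinTwistReduce hm (Nat.le_succ k) (t k)) 1
        (D.eisensteinComponent hm (k + 1) n hn' s) = D.eisensteinComponent hm k n hn s := by
  haveI := κ.fintypeQuotientLayer n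
  rw [eisensteinComponent_apply, eisensteinComponent_apply,
    (κ.unitTwist (-1)).map_eisensteinTwistReduce_coresEisenstein hm (Nat.le_succ k) (t k) (κ.layerSubgroup n)
      (layerSubgroup_le_unitTwist_layerSubgroup hm hn') (layerSubgroup_le_unitTwist_layerSubgroup hm hn)
      (κ.isOpen_layerSubgroup n),
    cohomologyMap_subgroupRepHom_eq_reduceTorsionH1 t ht,
    ((V.mem_compactSelmerOver_iff (κ.layerSubgroup n) p (D.proj n s)).1 (D.proj_mem n s)).2 k]

/-- **Compatibility at the canonical layers**: `H¹(eisensteinTwistReduce (t k)) (comp_{k+1} s) = comp_k s` with each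
component taken at its own layer `J_{k+1}`, `J_k` (the shape of `EisensteinH1Data.surj`).
[cite: Howard2004HeegnerKolyvagin, §2.2 and Def. 2.2.3] -/
theorem map_reduce_eisensteinComponent_self (hγ : κ.IsTopGenerator γ)
    (hE : ∀ P : V.toAffine.Point, p • P = 0 → P = 0) (k : ℕ) (s : D.S) :
    galoisCohomology.map ((κ.unitTwist (-1)).eisensteinTwistReduce hm (Nat.le_succ k) (t k)) 1
        (D.eisensteinComponent hm (k + 1) (eisensteinLevel (p := p) hm (k + 1)) le_rfl s) =
      D.eisensteinComponent hm k (eisensteinLevel (p := p) hm k) le_rfl s := by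
  rw [← D.eisensteinComponent_eq_self hm hγ hE (k + 1) (le_max_left _ (eisensteinLevel (p := p) hm k)),
    D.map_reduce_eisensteinComponent hm t ht k _ (le_max_left _ _) (le_max_right _ _),
    D.eisensteinComponent_eq_self hm hγ hE k]

/-! ## §2 The lift to the pinned `H¹(K, T_𝔮)` -/

variable (I : ZpExtension.EisensteinH1Data (κ.unitTwist (-1)) (fun k ↦ V.torsionGaloisModule ((p : ℤ) ^ k)) t hm)

/-- **Existence of the lift**: for every `s ∈ 𝔖_p(K_∞)` there is `h ∈ H = H¹(K, T_𝔮)` (pinned, `EisensteinH1Data`) with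
`proj k h = comp_k s` for all `k` (`EisensteinH1Data.surj` on the compatible family `(comp_k s)_k`).
[cite: Howard2004HeegnerKolyvagin, §2.2 and Def. 2.2.3 (the map 𝔖 → H¹(K, T_𝔮))] -/
theorem exists_forall_proj_eq_eisensteinComponent (hγ : κ.IsTopGenerator γ)
    (hE : ∀ P : V.toAffine.Point, p • P = 0 → P = 0) (s : D.S) :
    ∃ h : I.H, ∀ k, I.proj k h = D.eisensteinComponent hm k (eisensteinLevel (p := p) hm k) le_rfl s :=
  I.surj _ fun k ↦ D.map_reduce_eisensteinComponent_self hm t ht hγ hE k s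

/-- The lift of `s` (a choice; unique by `EisensteinH1Data.ext`, see `proj_toEisensteinH1Fun`).
[cite: Howard2004HeegnerKolyvagin, §2.2 and Def. 2.2.3] -/
def toEisensteinH1Fun (hγ : κ.IsTopGenerator γ) (hE : ∀ P : V.toAffine.Point, p • P = 0 → P = 0) (s : D.S) : I.H :=
  Classical.choose (D.exists_forall_proj_eq_eisensteinComponent hm t ht I hγ hE s)

/-- Defining property of the lift: `proj k (lift s) = comp_k s` at the canonical layer.
[cite: Howard2004HeegnerKolyvagin, §2.2 and Def. 2.2.3] -/
theorem proj_toEisensteinH1Fun (hγ : κ.IsTopGenerator γ) (hE : ∀ P : V.toAffine.Point, p • P = 0 → P = 0)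
    (s : D.S) (k : ℕ) :
    I.proj k (D.toEisensteinH1Fun hm t ht I hγ hE s) =
      D.eisensteinComponent hm k (eisensteinLevel (p := p) hm k) le_rfl s :=
  Classical.choose_spec (D.exists_forall_proj_eq_eisensteinComponent hm t ht I hγ hE s) k

/-- **The compact control map `𝔖_p(K_∞) → H¹(K, T_𝔮)`** (as an additive homomorphism; `Λ`-linearity in the sequel):
`s ↦` the unique `h` with `proj k h = cor_{Γ_n}^{Γ_K}(1 ⊗ (proj_n s)_k)` for all `k` (`n ≥ J_k`). This is Howard's map
`𝔖 = H¹(K, 𝐓) → H¹(K, T_𝔮)` induced by `𝐓 → T_𝔮 = 𝐓 ⊗_Λ S_𝔮`, `𝔮 = (T^m + p)`, the compact control map `f` of the cell's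
witness interface `SpecWitness` before restriction to the Selmer parts. Additivity: `proj k` of both sides agree
(`eisensteinComponent` is additive), and the `proj k` are jointly injective (`EisensteinH1Data.ext`).
[cite: Howard2004HeegnerKolyvagin, §2.2, Def. 2.2.3, Lemma 2.2.7 and Prop. 2.2.8] [cite: MazurRubinMemoirs2004, §5.3] -/
def toEisensteinH1 (hγ : κ.IsTopGenerator γ) (hE : ∀ P : V.toAffine.Point, p • P = 0 → P = 0) : D.S →+ I.H where
  toFun := D.toEisensteinH1Fun hm t ht I hγ hE
  map_zero' := I.ext _ fun k ↦ by rw [proj_toEisensteinH1Fun, map_zero]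
  map_add' s s' := (I.ext_iff').2 fun k ↦ by
    rw [map_add, proj_toEisensteinH1Fun, proj_toEisensteinH1Fun, proj_toEisensteinH1Fun, map_add]

/-- **`proj k (toEisensteinH1 s) = comp_{k,n} s` for EVERY layer `n ≥ J_k`** (defining property + independence of
the layer). [cite: Howard2004HeegnerKolyvagin, §2.2 and Def. 2.2.3] -/
theorem proj_toEisensteinH1 (hγ : κ.IsTopGenerator γ) (hE : ∀ P : V.toAffine.Point, p • P = 0 → P = 0)
    (s : D.S) (k : ℕ) {n : ℕ} (hn : eisensteinLevel (p := p) hm k ≤ n) :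
    I.proj k (D.toEisensteinH1 hm t ht I hγ hE s) = D.eisensteinComponent hm k n hn s := by
  rw [D.eisensteinComponent_eq_self hm hγ hE k hn]
  exact D.proj_toEisensteinH1Fun hm t ht I hγ hE s k

/-- The lift is characterised by its projections: `h = toEisensteinH1 s` iff `proj k h = comp_k s` for all `k`.
[cite: Howard2004HeegnerKolyvagin, §2.2 and Def. 2.2.3] -/
theorem eq_toEisensteinH1_iff (hγ : κ.IsTopGenerator γ) (hE : ∀ P : V.toAffine.Point, p • P = 0 → P = 0)
    (s : D.S) (h : I.H) :
    h = D.toEisensteinH1 hm t ht I hγ hE s ↔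
      ∀ k, I.proj k h = D.eisensteinComponent hm k (eisensteinLevel (p := p) hm k) le_rfl s := by
  rw [I.ext_iff']
  refine forall_congr' fun k ↦ ?_
  rw [D.proj_toEisensteinH1 hm t ht I hγ hE s k le_rfl]

end Reduce

end WeierstrassCurve.LambdaAdicSelmerData

end
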